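import Literature.NumberTheory.Transcendental.KZCalculus
import Literature.NumberTheory.Transcendental.KZSemialgebraicComplex
import Literature.NumberTheory.Transcendental.KZBallPeelingAux

/-!
# `NormalFormPrinciple` (stmt-KontsevichZagierPeriods-3869), line `SketchIdeator1` — registered
# sub-goal `slabA_sub_pt_mem_relations`, as an explicit three-generator certificate

Pure proof file (`--supports` the crux stmt-KontsevichZagierPeriods-3869; siege attempt k20,
variation "certificate on the finite core"). No definitions are introduced.

The registered sub-goal (algebraic-pole layer of the leaf `stub_boxRigidity`, lead seat c3, file
`AlgKit`) reads: for real ALGEBRAIC `α ≤ β`, an interval representation `N = [(α,β), f]` of the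
Kontsevich–Zagier calculus and a primitive `F` of `f` on `(α,β)` which is continuous on `[α,β]` and
`ℚ`-semialgebraic on the closed slab (read on the first coordinate), one has
`[N] − [Z] ∈ KZ.relations` for every point representation `Z = [pt, F(β) − F(α)]` over `ℝ⁰`.

## The certificate

Rather than chaining congruence lemmas, this file exhibits the relation as an explicit word in
THREE generators of `KZ.relations` (`slabA_certificate`): with the closed-slab representation
`R = [[α,β], f]` and the endpoint representation `E = [{α, β}, f]` (a Lebesgue-null,
`ℚ`-semialgebraic two-hyperplane set),

  `[N] − [Z] = g₁ − g₂ + g₃`,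

* `g₁ = [R] − [Z] ∈ newtonLeibnizRel` — ONE Newton–Leibniz generator over the point (rule (3)
  with base dimension `0`, bounds the algebraic constants `α ≤ β`, primitive `z ↦ F (z 0)`);
* `g₂ = [R] − [N] − [E] ∈ domainAddRel` — rule (1a): `[α,β] = (α,β) ∪ {α,β}`, the overlap is
  empty, and `R`'s integrand agrees with `N`'s on `N.domain` (hypothesis `hNi`) — `N` ITSELF is
  the first summand, no intermediate restriction is needed;
* `g₃ = [E] − [E] − [E] ∈ domainAddRel` — the degenerate instance of rule (1a) on the null set
  `{α, β}` (`E.domain = E.domain ∪ E.domain`, null overlap), i.e. `−[E]` is a generator.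

The finite core — the identity `[N] − [Z] = g₁ − g₂ + g₃` in the free abelian group — is decided
by `abel`; membership (`slabA_sub_pt_mem_relations`) is then closure under `+/−`
(`mem_relations_of_certificate`). Rules (1b) (integrand additivity) and (2) (change of
variables) are not used.

Inputs: `isSemialgebraic_setOf_apply_eq_of_isAlgebraic` / `isSemialgebraicFunOn_const_of_isAlgebraic`
(real algebraic constants are `ℚ`-definable, KZ §1.1), `KZ.BallPeeling.volume_setOf_apply_eq_const`
(coordinate hyperplanes are null), `IsSemialgebraicFunOn.mono`, `Set.Ioo_union_both`.

Sources: M. Kontsevich, D. Zagier, *Periods* (2001), §1.2 rules (1), (3); J. Bochnak, M. Coste,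
M.-F. Roy, *Real Algebraic Geometry* (1998), §2.2 (restriction of semialgebraic functions).
-/

noncomputable section

open MeasureTheory Set
open Literature.NumberTheory.Transcendental Literature.NumberTheory.Transcendental.KZ
open Literature.ModelTheory.ExponentialFields (IsSemialgebraic isSemialgebraic_univ)

namespace Summit.KontsevichZagierPeriods.HurwitzMicroSectors.NormalFormPrinciple.PiBox

namespace SlabACert

/-- The two-endpoint set `{x | x i = a} ∪ {x | x i = b} ⊂ ℝⁿ` is Lebesgue-null (two coordinate
hyperplanes, `KZ.BallPeeling.volume_setOf_apply_eq_const`). [folklore] -/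
theorem volume_endpoints_eq_zero {n : ℕ} (i : Fin n) (a b : ℝ) :
    volume ({x : Fin n → ℝ | x i = a} ∪ {x | x i = b}) = 0 :=
  measure_union_null (BallPeeling.volume_setOf_apply_eq_const n i a)
    (BallPeeling.volume_setOf_apply_eq_const n i b)

/-- The two-endpoint set `{x | x i = a} ∪ {x | x i = b}` with real ALGEBRAIC `a`, `b` is
`ℚ`-semialgebraic (algebraic constants are `ℚ`-definable).
[cite: KontsevichZagier2001, §1.1] -/
theorem isSemialgebraic_endpoints {n : ℕ} {a b : ℝ} (ha : IsAlgebraic ℚ a) (hb : IsAlgebraic ℚ b)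
    (i : Fin n) : IsSemialgebraic ℚ ({x : Fin n → ℝ | x i = a} ∪ {x | x i = b}) :=
  (isSemialgebraic_setOf_apply_eq_of_isAlgebraic ha i).union
    (isSemialgebraic_setOf_apply_eq_of_isAlgebraic hb i)

/-- The closed coordinate slab is the open slab plus the two endpoint hyperplanes:
`{x | x i ∈ [a,b]} = {x | x i ∈ (a,b)} ∪ ({x | x i = a} ∪ {x | x i = b})` for `a ≤ b`
(`Set.Ioo_union_both`). [folklore] -/
theorem setOf_apply_mem_Icc_eq_union {n : ℕ} {a b : ℝ} (hab : a ≤ b) (i : Fin n) :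
    {x : Fin n → ℝ | x i ∈ Set.Icc a b} =
      {x | x i ∈ Set.Ioo a b} ∪ ({x : Fin n → ℝ | x i = a} ∪ {x | x i = b}) := by
  ext x
  rw [mem_setOf_eq, ← Ioo_union_both hab]
  simp only [mem_union, mem_insert_iff, mem_singleton_iff, mem_setOf_eq]

/-- **Closure step of the certificate.** A word `g₁ − g₂ + g₃` in a Newton–Leibniz generator `g₁`
and two domain-additivity generators `g₂`, `g₃` lies in `KZ.relations`.
[cite: KontsevichZagier2001, §1.2] -/
theorem mem_relations_of_certificate {c g₁ g₂ g₃ : FormalRep} (h₁ : g₁ ∈ newtonLeibnizRel)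
    (h₂ : g₂ ∈ domainAddRel) (h₃ : g₃ ∈ domainAddRel) (hc : c = g₁ - g₂ + g₃) :
    c ∈ relations := by
  rw [hc]
  exact relations.add_mem (relations.sub_mem (newtonLeibnizRel_subset_relations h₁)
    (domainAddRel_subset_relations h₂)) (domainAddRel_subset_relations h₃)

/-- **The certificate.** Under the hypotheses of the registered sub-goal
`slabA_sub_pt_mem_relations` (real algebraic `α ≤ β`, `N = [(α,β), f]`, a primitive `F` of `f` on
`(α,β)` continuous on `[α,β]` and `ℚ`-semialgebraic on the closed slab, `Z = [pt, F(β) − F(α)]`),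
there are a Newton–Leibniz generator `g₁` and two domain-additivity generators `g₂`, `g₃` of the
Kontsevich–Zagier calculus with `[N] − [Z] = g₁ − g₂ + g₃`; explicitly `g₁ = [R] − [Z]`,
`g₂ = [R] − [N] − [E]`, `g₃ = [E] − [E] − [E]` for the closed-slab representation `R = [[α,β], f]`
and the (null) endpoint representation `E = [{α,β}, f]`.
[cite: KontsevichZagier2001, §1.2 rules (1), (3)] -/
theorem slabA_certificate {α β : ℝ} (hα : IsAlgebraic ℚ α) (hβ : IsAlgebraic ℚ β)
    (hαβ : α ≤ β) (f F : ℝ → ℝ)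
    (hF : IsSemialgebraicFunOn ℚ {x : Fin 1 → ℝ | x 0 ∈ Set.Icc α β} (fun x => F (x 0)))
    (hFc : ContinuousOn F (Set.Icc α β))
    (hderiv : ∀ t ∈ Set.Ioo α β, HasDerivAt F (f t) t)
    (hf : IsSemialgebraicFunOn ℚ {x : Fin 1 → ℝ | x 0 ∈ Set.Icc α β} (fun x => f (x 0)))
    (N : IntegralRep 1) (hNd : N.domain = {x | x 0 ∈ Set.Ioo α β})
    (hNi : EqOn N.integrand (fun x => f (x 0)) N.domain)
    (Z : IntegralRep 0) (hZd : Z.domain = univ) (hZi : Z.integrand = fun _ => F β - F α) :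
    ∃ g₁ ∈ newtonLeibnizRel, ∃ g₂ ∈ domainAddRel, ∃ g₃ ∈ domainAddRel,
      of N - of Z = g₁ - g₂ + g₃ := by
  -- the three sets: closed slab `C`, open slab `N.domain`, endpoints `D`
  set C : Set (Fin 1 → ℝ) := {x | x 0 ∈ Set.Icc α β} with hC
  set D : Set (Fin 1 → ℝ) := {x : Fin 1 → ℝ | x 0 = α} ∪ {x | x 0 = β} with hD
  have hCeq : C = N.domain ∪ D := by
    rw [hC, hNd, hD]
    exact setOf_apply_mem_Icc_eq_union hαβ 0
  have hDsa : IsSemialgebraic ℚ D := isSemialgebraic_endpoints hα hβ 0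
  have hDnull : volume D = 0 := volume_endpoints_eq_zero 0 α β
  have hDC : D ⊆ C := hCeq ▸ subset_union_right
  have hCsa : IsSemialgebraic ℚ C := hCeq ▸ N.isSemialgebraic_domain.union hDsa
  -- integrability of `x ↦ f (x 0)`: on `N.domain` it is `N.integrand`, and `D` is null
  have hfN : IntegrableOn (fun x : Fin 1 → ℝ => f (x 0)) N.domain :=
    N.integrableOn.congr_fun hNi (IntegralRep.measurableSet_domain_holds N)
  have hfD : IntegrableOn (fun x : Fin 1 → ℝ => f (x 0)) D :=
    IntegrableOn.of_measure_zero hDnull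
  have hfC : IntegrableOn (fun x : Fin 1 → ℝ => f (x 0)) C := hCeq ▸ hfN.union hfD
  -- the closed-slab representation `R = [[α,β], f]` and the endpoint representation `E`
  obtain ⟨R, hRd, hRi⟩ : ∃ R : IntegralRep 1, R.domain = C ∧ R.integrand = fun x => f (x 0) :=
    ⟨⟨C, fun x => f (x 0), hCsa, hf, hfC⟩, rfl, rfl⟩
  obtain ⟨E, hEd, hEi⟩ : ∃ E : IntegralRep 1, E.domain = D ∧ E.integrand = fun x => f (x 0) :=
    ⟨⟨D, fun x => f (x 0), hDsa, hf.mono hDC hDsa, hfD⟩, rfl, rfl⟩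
  have hs0 : ∀ (x : Fin 0 → ℝ) (t : ℝ), (Fin.snoc x t : Fin 1 → ℝ) 0 = t := fun _ _ => rfl
  -- generator 1: ONE Newton–Leibniz move over `ℝ⁰`, primitive `z ↦ F (z 0)`
  have h₁ : of R - of Z ∈ newtonLeibnizRel := by
    refine ⟨0, R, Z, fun _ => α, fun _ => β, fun z => F (z 0), ?_, ?_, ?_,
      fun _ _ => hαβ, ?_, ?_, ?_, ?_, rfl⟩
    · rw [hRd]
      exact hF
    · rw [hZd]
      exact isSemialgebraicFunOn_const_of_isAlgebraic isSemialgebraic_univ hα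
    · rw [hZd]
      exact isSemialgebraicFunOn_const_of_isAlgebraic isSemialgebraic_univ hβ
    · rw [hRd, hZd, hC]
      ext z
      simp only [Set.mem_setOf_eq, Set.mem_Icc, Set.mem_univ, true_and]
      rfl
    · intro x _
      simp only [hs0]
      exact hFc
    · intro x _ t ht
      rw [hRi]
      simp only [hs0]
      exact hderiv t ht
    · intro x _
      rw [hZi]
      simp only [hs0]
  -- generator 2: domain additivity `[α,β] = (α,β) ∪ {α,β}` with `N` itself as first summand
  have h₂ : of R - of N - of E ∈ domainAddRel := by
    refine ⟨1, R, N, E, ?_, ?_, ?_, ?_, rfl⟩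
    · rw [hRd, hEd]
      exact hCeq
    · rw [hEd]
      exact measure_mono_null inter_subset_right hDnull
    · intro x hx
      rw [hRi]
      exact (hNi hx).symm
    · rw [hRi, hEi]
      exact fun _ _ => rfl
  -- generator 3: the degenerate domain-additivity instance on the null set `{α,β}`
  have h₃ : of E - of E - of E ∈ domainAddRel := by
    refine ⟨1, E, E, E, (union_self _).symm, ?_, fun _ _ => rfl, fun _ _ => rfl, rfl⟩
    rw [inter_self, hEd]
    exact hDnull
  -- the finite core: the identity in the free abelian group
  exact ⟨_, h₁, _, h₂, _, h₃, by abel⟩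

/-- **Newton–Leibniz over the point, algebraic ends** (registered sub-goal
`slabA_sub_pt_mem_relations` of crux stmt-KontsevichZagierPeriods-3869, verbatim signature). Let
`α ≤ β` be real algebraic, `N = [(α,β), f]` an interval representation whose integrand `x ↦ f(x₀)`
is `ℚ`-semialgebraic on the closed slab, and `F` a primitive of `f` on `(α,β)`, continuous on
`[α,β]` and `ℚ`-semialgebraic on the closed slab. Then `[N] − [Z] ∈ KZ.relations` for every point
representation `Z = [pt, F(β) − F(α)]` over `ℝ⁰` — by the explicit three-generator certificate
`slabA_certificate`. [cite: KontsevichZagier2001, §1.2 rule (3)] -/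
theorem slabA_sub_pt_mem_relations {α β : ℝ} (hα : IsAlgebraic ℚ α) (hβ : IsAlgebraic ℚ β)
    (hαβ : α ≤ β) (f F : ℝ → ℝ)
    (hF : IsSemialgebraicFunOn ℚ {x : Fin 1 → ℝ | x 0 ∈ Set.Icc α β} (fun x => F (x 0)))
    (hFc : ContinuousOn F (Set.Icc α β))
    (hderiv : ∀ t ∈ Set.Ioo α β, HasDerivAt F (f t) t)
    (hf : IsSemialgebraicFunOn ℚ {x : Fin 1 → ℝ | x 0 ∈ Set.Icc α β} (fun x => f (x 0)))
    (N : IntegralRep 1) (hNd : N.domain = {x | x 0 ∈ Set.Ioo α β})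
    (hNi : EqOn N.integrand (fun x => f (x 0)) N.domain)
    (Z : IntegralRep 0) (hZd : Z.domain = univ) (hZi : Z.integrand = fun _ => F β - F α) :
    of N - of Z ∈ relations := by
  obtain ⟨g₁, h₁, g₂, h₂, g₃, h₃, hc⟩ :=
    slabA_certificate hα hβ hαβ f F hF hFc hderiv hf N hNd hNi Z hZd hZi
  exact mem_relations_of_certificate h₁ h₂ h₃ hc

end SlabACert

end Summit.KontsevichZagierPeriods.HurwitzMicroSectors.NormalFormPrinciple.PiBox
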